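/-
HONEST FRAMING: certified error envelopes and provably optimal rounding/accumulation schemes for
low-precision formats under stated cost models; every table by two implementations; no hardware
or vendor claims.
-/
import Summits.Ventures.CertifiedArithmetic.LowPrec.OptDemotionMonoWNodeI

/-!
# The demotion law (Theorem T8), part 6i: closing lemmas for the BOTH-BELOW node step (MONO and W)

HOME `CONJECTURE-D-NODESTEP.md` §G10.2 (ii): at a node `a·b` with computed value
`v = fl(v_a + v_b) ∈ [σ, 2σ)` and BOTH children in the binade just below (`σ/2 ≤ v_a, v_b < σ`), the
node deficit is covered by a line of `L_{a·b}` provided both children satisfy MONO (z-form,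
`MonoZTree`, part 6h) and W (`WTree`, part 6f).  Route (all line-level lemmas from part 6g):
raise the lighter reading to the full-loss excess sum `t = 2x + 2u`; if `t ≥ 1` the max-slope exchange
(`exchange_cover`) leaves one child exactly at the root scale and the other squeezed at excess
`ξ = t - 1`, whose reading MONO turns into the transposed option `F3`/`F4` (`below_close_exchange`);
if `t < 1` the affine reduction (`affine_endpoints`) leaves one child exactly at `σ/2`, and W of the
other child empties the window (`window_cover_of_W`), the two covers being `F1` of the active line at
`x` and — through MONO again — `F4`/`F3` (`below_close_window`).

* `allLines_swap` — `L_{b·a} ⊆ L_{a·b}` (the family is symmetric);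
* `envG_mono` — the envelope is monotone; `envG_zero` — `G_t(0) = μ_t`;
* `below_close_exchange`, `below_close_window` — the two closing steps (oriented; any trees `c, d`).
The float-level node step itself (`node_line_below`) is part 6j (`OptDemotionMonoWNodeIII`).
The MIXED configurations (`v_a ∈ [σ/2, σ)`, `v_b < σ/2`) are NOT treated here (memo §G10.6: covered
numerically by the same four readings; one sub-case of the paper proof open).
-/

namespace Summit.Ventures.CertifiedArithmetic.LowPrec.Opt

open Literature.ComputerArithmetic.JeannerodRump2018
open Literature.ComputerArithmetic.JeannerodRump2018.SumTree
open Demotion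

/-! ## Small envelope / family facts -/

/-- The full family is symmetric in the children: `L_{b·a} ⊆ L_{a·b}`. -/
theorem allLines_swap {u : ℚ} {a b : SumTree} {l : ℚ × ℚ} (h : l ∈ allLines u (.node b a)) :
    l ∈ allLines u (.node a b) := by
  rcases mem_allLines_node h with ⟨m, hm, rfl⟩ | ⟨m, hm, rfl⟩ | ⟨m, hm, rfl⟩ | ⟨m, hm, rfl⟩
  · exact mem_allLines_F2 (a := a) hm
  · exact mem_allLines_F1 (b := b) hm
  · exact mem_allLines_F4 (b := b) hm
  · exact mem_allLines_F3 (a := a) hm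

/-- `G_t(0) = μ_t`. -/
theorem envG_zero {u : ℚ} (hu0 : 0 ≤ u) (hu1 : u ≤ 1) (t : SumTree) : envG u t 0 = treeM u t - 1 := by
  unfold envG; rw [treeQf_zero hu0 hu1 t]; ring

/-- The envelope is monotone on `[0, ∞)`. -/
theorem envG_mono {u : ℚ} (hu : 0 < u) (hu1 : u ≤ 1) (t : SumTree) {ρ ρ' : ℚ} (hρ : 0 ≤ ρ)
    (hρρ' : ρ ≤ ρ') : envG u t ρ ≤ envG u t ρ' := by
  rcases eq_or_lt_of_le hρ with h0 | hpos
  · rw [← h0, envG_zero hu.le hu1 t]; exact envG_ge_mu hu hu1 t (h0 ▸ hρρ' : (0:ℚ) ≤ ρ')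
  · obtain ⟨l, hl, he⟩ := exists_line_eq_envG hu t hpos
    have h1 := line_le_envG hu hu1 t hl (le_trans hρ hρρ')
    have hl2 := (allLines_bounds hu.le hu1 t l hl).1
    rw [he]; nlinarith [mul_le_mul_of_nonneg_left hρρ' hl2]

/-! ## The two closing steps (oriented: `c` is credited at the root scale, `d` is squeezed) -/

section Close

variable {q : ℕ}

-- buildfix (ops-buildfix-2 g10, 2026-08-21): the lane `lake build` hit the 200000-heartbeat cliff at this declaration
-- (6 retries rc 1 `timeout at whnf` :67, 04:01–04:45Z) while the farm check passes; proof and statement unchanged.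
set_option maxHeartbeats 400000 in
/-- **CLOSING AN EXCHANGE.**  Root scale `σ = 2τ`, root excess `x = 2ju > 0` (`1 ≤ j < 2^(q-1)`),
`v = σ(1+x)`; after `exchange_cover` the node quantity `T` is below
`σ·μ_c + τ·(ℓ_d.1 + ℓ_d.2·ξ) + r` with `τ(1+ξ) = σ(x+u)` (the squeezed child at value `xσ + uσ`,
true scale `τ`), `r ≤ uσ`.  MONO of `d` (z-form at `j`) turns the squeezed reading into the transposed
option: some line of `L_{c·d}` covers `T` at scale `σ`. -/
theorem below_close_exchange (hq : 1 ≤ q) (c d : SumTree) {σ τ x r T ξ : ℚ} {j : ℕ}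
    (hσ : σ = 2 * τ) (hτ : 0 < τ) (hj1 : 1 ≤ j) (hjlt : j < 2 ^ (q - 1))
    (hx : x = 2 * (j : ℚ) * unitRoundoff q) (hξ : τ * (1 + ξ) = σ * (x + unitRoundoff q))
    (hξ0 : 0 ≤ ξ) {ld : ℚ × ℚ} (hld : ld ∈ allLines (unitRoundoff q) d) (hMd : MonoZTree q d)
    (hr : r ≤ unitRoundoff q * σ)
    (hT : T ≤ σ * (treeM (unitRoundoff q) c - 1) + τ * (ld.1 + ld.2 * ξ) + r) :
    ∃ l ∈ allLines (unitRoundoff q) (.node c d), T ≤ σ * (l.1 - l.2) + l.2 * (σ * (1 + x)) := by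
  set u := unitRoundoff q with hudef
  have hupos : 0 < u := by rw [hudef]; unfold unitRoundoff; positivity
  have hu1 : u ≤ 1 := unitRoundoff_le_one q
  have hσpos : 0 < σ := by rw [hσ]; linarith
  have hj1q : (1 : ℚ) ≤ j := by exact_mod_cast hj1
  have hjpos : (0 : ℚ) < j := by linarith
  -- the squeezed reading is below the envelope at ξ, scale τ
  have h1 : τ * (ld.1 + ld.2 * ξ) ≤ τ * envG u d ξ :=
    mul_le_mul_of_nonneg_left (line_le_envG hupos hu1 d hld hξ0) hτ.le
  -- identify τ with the binade of y = (2j+1)uσ: betaOf u j * σ = τ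
  set n := Nat.log2 (2 * j + 1) with hn
  have hβ : betaOf u j = (2 : ℚ) ^ n * u := rfl
  have hβlo : (2 : ℚ) ^ n ≤ 2 * (j : ℚ) + 1 := by
    have h := Nat.log2_self_le (n := 2 * j + 1) (by omega); exact_mod_cast h
  have hβhi : 2 * (j : ℚ) + 1 < 2 * (2 : ℚ) ^ n := by
    have h := Nat.lt_log2_self (n := 2 * j + 1)
    rw [pow_succ] at h
    have : ((2 * j + 1 : ℕ) : ℚ) < ((2 ^ Nat.log2 (2 * j + 1) * 2 : ℕ) : ℚ) := by exact_mod_cast h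
    push_cast at this; linarith
  have hβpos : 0 < betaOf u j := betaOf_pos hupos j
  -- y = σ(x+u) = (2j+1)uσ; τ ≤ y < 2τ from hξ (0 ≤ ξ) and ξ < 1 is not needed: use the powers of two
  have hy : σ * (x + u) = (2 * (j : ℚ) + 1) * u * σ := by rw [hx]; ring
  -- both βσ := betaOf u j * σ and τ lie in (y/2, y]; they are powers of two times (uσ):
  -- τ = 2^(q-1) · uσ.  Compare exponents through inequalities.
  have huσ : 0 < u * σ := mul_pos hupos hσpos
  have hτy : τ ≤ (2 * (j : ℚ) + 1) * u * σ := by nlinarith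
  have hβy1 : betaOf u j * σ ≤ (2 * (j : ℚ) + 1) * u * σ := by rw [hβ]; nlinarith
  have hβy2 : (2 * (j : ℚ) + 1) * u * σ < 2 * (betaOf u j * σ) := by rw [hβ]; nlinarith
  -- τ expressed with u: 2 u τ · 2^(q-1) = τ, i.e. τ = 2^(q-1) u σ
  have hpow : (2 : ℚ) ^ q = 2 * 2 ^ (q - 1) := by
    conv_lhs => rw [← Nat.sub_add_cancel hq, pow_succ]
    ring
  have hu2q : u * (2 : ℚ) ^ (q - 1) = 1 / 2 := by
    rw [hudef]; unfold unitRoundoff; rw [hpow]; field_simp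
  have hτu : τ = (2 : ℚ) ^ (q - 1) * (u * σ) := by
    have : (2 : ℚ) ^ (q - 1) * (u * σ) = (u * (2 : ℚ) ^ (q - 1)) * σ := by ring
    rw [this, hu2q, hσ]; ring
  -- 2^n vs 2^(q-1): from βσ ≤ y < 2τ·(…) and τ ≤ y < 2βσ
  have hy2τ : (2 * (j : ℚ) + 1) * u * σ < 2 * τ := by
    -- y = σ(x+u) < σ since x + u ≤ 1 - u < 1 (j < 2^(q-1) ⇒ 2ju ≤ 1 - 2u)
    have hjq : (j : ℚ) ≤ 2 ^ (q - 1) - 1 := by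
      have : (j : ℚ) + 1 ≤ ((2 ^ (q - 1) : ℕ) : ℚ) := by exact_mod_cast hjlt
      push_cast at this; linarith
    have hxu : x + u ≤ 1 - u := by
      rw [hx]; nlinarith [hu2q, hupos]
    rw [← hy, hσ]; nlinarith
  have hn_le : (2 : ℚ) ^ n ≤ (2 : ℚ) ^ (q - 1) := by
    -- βσ = 2^n uσ ≤ y < 2τ = 2^q uσ  ⇒ 2^n < 2^q ⇒ n ≤ q-1
    have h3 : (2 : ℚ) ^ n * (u * σ) < (2 : ℚ) ^ q * (u * σ) := by
      have : 2 * τ = (2 : ℚ) ^ q * (u * σ) := by rw [hτu, hpow]; ring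
      rw [hβ] at hβy1; nlinarith
    have h4 : (2 : ℚ) ^ n < (2 : ℚ) ^ q := lt_of_mul_lt_mul_right h3 huσ.le
    have h5 : n < q := by
      by_contra hc; push Not at hc
      have := pow_le_pow_right₀ (by norm_num : (1 : ℚ) ≤ 2) hc; linarith
    exact pow_le_pow_right₀ (by norm_num) (by omega)
  have hn_ge : (2 : ℚ) ^ (q - 1) ≤ (2 : ℚ) ^ n := by
    -- τ = 2^(q-1) uσ ≤ y < 2βσ = 2^(n+1) uσ ⇒ q-1 ≤ n
    have h3 : (2 : ℚ) ^ (q - 1) * (u * σ) < (2 : ℚ) ^ (n + 1) * (u * σ) := by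
      rw [pow_succ, hβ] at *; nlinarith
    have h4 : (2 : ℚ) ^ (q - 1) < (2 : ℚ) ^ (n + 1) := lt_of_mul_lt_mul_right h3 huσ.le
    have h5 : q - 1 < n + 1 := by
      by_contra hc; push Not at hc
      have := pow_le_pow_right₀ (by norm_num : (1 : ℚ) ≤ 2) hc; linarith
    exact pow_le_pow_right₀ (by norm_num) (by omega)
  have hβτ : betaOf u j * σ = τ := by
    rw [hβ, hτu, le_antisymm hn_le hn_ge]; ring
  -- ξ is MONO's excess: (2j+1)u/betaOf - 1 = ξ
  have hξeq : (2 * (j : ℚ) + 1) * u / betaOf u j - 1 = ξ := by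
    have hne : betaOf u j ≠ 0 := ne_of_gt hβpos
    have : betaOf u j * (1 + ξ) = (2 * (j : ℚ) + 1) * u := by
      have h := hξ; rw [← hβτ, hy] at h
      have := mul_right_cancel₀ (ne_of_gt hσpos) (by linarith : betaOf u j * (1 + ξ) * σ = (2 * (j : ℚ) + 1) * u * σ)
      linarith
    field_simp; linarith
  -- MONO(d) at j
  have hmono : betaOf u j * envG u d ξ ≤ 2 * (j : ℚ) * u * envG u d (1 / (2 * (j : ℚ))) := by
    have h := hMd j hj1 hjlt
    unfold MonoZPt at h
    rw [hξeq] at h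
    exact h
  have hρpos : (0 : ℚ) < 1 / (2 * (j : ℚ)) := div_pos one_pos (by linarith)
  obtain ⟨ld', hld', hGe⟩ := exists_line_eq_envG hupos d hρpos
  have hread : τ * envG u d ξ ≤ ld'.1 * (x * σ) + ld'.2 * (u * σ) := by
    have e : 2 * (j : ℚ) * u * envG u d (1 / (2 * (j : ℚ))) * σ
        = ld'.1 * (x * σ) + ld'.2 * (u * σ) := by
      rw [hGe, hx]; field_simp
    have h := mul_le_mul_of_nonneg_right hmono hσpos.le
    rw [e] at h
    have h3 : betaOf u j * envG u d ξ * σ = τ * envG u d ξ := by rw [← hβτ]; ring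
    linarith
  refine ⟨_, mem_allLines_F3 (a := c) hld', ?_⟩
  dsimp only
  nlinarith [mul_pos hupos hσpos]

/-- **CLOSING A WINDOW.**  Root scale `σ = 2τ`, root excess `x = 2ju ≥ 0` with `t = 2x + 2u < 1`,
`v = σ(1+x)`; after `affine_endpoints` the node quantity `T` is below
`τ·(ℓ_c.1 + ℓ_c.2·t) + τ·μ_d + r`, `r ≤ uσ` (child `c` at the top of the lower binade with the whole
excess, `d` exactly at `τ`).  W of `c` at `y = x` empties the window (`window_cover_of_W`): either
`F1` of `c`'s active line at `x` covers, or the squeezed reading `μ_d + B_c(x)` does, which MONO of `c`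
(z-form at `j`, or `B_c(0) = uμ_c` when `x = 0`) turns into `F4`. -/
theorem below_close_window (hq : 1 ≤ q) (c d : SumTree) {σ τ x r T : ℚ} {j : ℕ}
    (hσ : σ = 2 * τ) (hτ : 0 < τ) (hjlt : j < 2 ^ q)
    (hx : x = 2 * (j : ℚ) * unitRoundoff q) (ht : 2 * x + 2 * unitRoundoff q < 1)
    {lc : ℚ × ℚ} (hlc : lc ∈ allLines (unitRoundoff q) c)
    (hMc : MonoZTree q c) (hWc : WTree q c) (hr : r ≤ unitRoundoff q * σ)
    (hT : T ≤ τ * (lc.1 + lc.2 * (2 * x + 2 * unitRoundoff q)) + τ * (treeM (unitRoundoff q) d - 1) + r) :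
    ∃ l ∈ allLines (unitRoundoff q) (.node c d), T ≤ σ * (l.1 - l.2) + l.2 * (σ * (1 + x)) := by
  set u := unitRoundoff q with hudef
  have hu0 : 0 ≤ u := unitRoundoff_nonneg q
  have hupos : 0 < u := by rw [hudef]; unfold unitRoundoff; positivity
  have hu1 : u ≤ 1 := unitRoundoff_le_one q
  have hu2 : u ≤ 1 / 2 := unitRoundoff_le_half hq
  have hσpos : 0 < σ := by rw [hσ]; linarith
  have hj0 : (0 : ℚ) ≤ j := Nat.cast_nonneg j
  have hx0 : 0 ≤ x := by rw [hx]; positivity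
  set μd := treeM u d - 1 with hμd
  have hμd0 : 0 ≤ μd := by have := one_le_treeM hu0 d; rw [hμd]; linarith
  -- W(c) at grid y = x (index j)
  have hW := hWc j hjlt (by rw [← hudef, ← hx]; exact ht)
  unfold WPt at hW
  rw [← hudef] at hW
  rw [← hx] at hW
  set B := betaOf u j * envG u c ((2 * (j : ℚ) + 1) * u / betaOf u j - 1) with hB
  -- the reading of c at excess t is below V = G_c(2x+2u)
  have hV : lc.1 + lc.2 * (2 * x + 2 * u) ≤ envG u c (2 * x + 2 * u) :=
    line_le_envG hupos hu1 c hlc (by positivity)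
  have hW' : (1 - u) * envG u c (2 * x + 2 * u) ≤ envG u c x + (1 - 2 * u) * B := by
    rw [hB]; linarith [hW]
  have hwin := window_cover_of_W μd hu2 hW'
  -- T ≤ τ (V + μ_d) + r = σ (V + μ_d)/2 + r
  have hT' : T ≤ σ * ((envG u c (2 * x + 2 * u) + μd) / 2) + r := by
    rw [hσ]; nlinarith [mul_le_mul_of_nonneg_left hV hτ.le]
  rcases le_max_iff.mp hwin with h1 | h2
  · -- F1 of c's active line at x (the μ-line when x = 0)
    have hσ1 := mul_le_mul_of_nonneg_left h1 hσpos.le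
    rcases eq_or_lt_of_le hx0 with hx00 | hxpos
    · refine ⟨_, mem_allLines_F1 (b := d) (mu_mem_allLines hu0 hu1 c), ?_⟩
      dsimp only
      have hG0 : envG u c x = treeM u c - 1 := by rw [← hx00]; exact envG_zero hu0 hu1 c
      rw [hG0] at hσ1
      have huσ := mul_pos hupos hσpos
      nlinarith
    · obtain ⟨l, hl, hle⟩ := exists_line_eq_envG hupos c hxpos
      refine ⟨_, mem_allLines_F1 (b := d) hl, ?_⟩
      dsimp only
      rw [hle] at hσ1
      have huσ := mul_pos hupos hσpos
      nlinarith
  · -- the squeezed reading μ_d + B_c(x), then MONO(c) (or B_c(0) = u μ_c)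
    have hσ2 := mul_le_mul_of_nonneg_left h2 hσpos.le
    rcases Nat.eq_zero_or_pos j with hj0' | hjpos
    · -- x = 0: B = u · G_c(0) = u μ_c; the line F2 of d's μ-line: (μ_d + u + u μ_c, 0)
      have hj0q : ((j : ℕ) : ℚ) = 0 := by rw [hj0']; simp
      have hx00 : x = 0 := by rw [hx, hj0q]; ring
      have hlog : Nat.log2 (2 * 0 + 1) = 0 := by decide
      have hβ0 : betaOf u j = u := by unfold betaOf; rw [hj0', hlog]; simp
      have harg : (2 * (j : ℚ) + 1) * u / betaOf u j - 1 = 0 := by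
        rw [hβ0, hj0q]; field_simp; ring
      have hB0 : B = u * (treeM u c - 1) := by rw [hB, harg, hβ0, envG_zero hu0 hu1 c]
      refine ⟨_, mem_allLines_F2 (a := c) (mu_mem_allLines hu0 hu1 d), ?_⟩
      dsimp only
      rw [hB0] at hσ2
      rw [hx00] at hσ2 ⊢
      have huσ := mul_pos hupos hσpos
      nlinarith
    · have hj1 : 1 ≤ j := hjpos
      have hjlt' : j < 2 ^ (q - 1) := by
        -- 2x + 2u < 1 with x = 2ju  ⇒  (4j + 2)u < 1 ⇒ j < 2^(q-1)
        have hpow : (2 : ℚ) ^ q = 2 * 2 ^ (q - 1) := by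
          conv_lhs => rw [← Nat.sub_add_cancel hq, pow_succ]
          ring
        have hu2q : u * (2 : ℚ) ^ (q - 1) = 1 / 2 := by
          rw [hudef]; unfold unitRoundoff; rw [hpow]; field_simp
        have h4 : (4 * (j : ℚ) + 2) * u < 1 := by rw [hx] at ht; linarith
        have h5 : (j : ℚ) * u < 1 / 4 := by linarith
        have h' : (j : ℚ) < 2 ^ (q - 1) := by
          have h6 : (j : ℚ) * u * (2 * (2 : ℚ) ^ (q - 1)) < (1 / 4) * (2 * (2 : ℚ) ^ (q - 1)) :=
            mul_lt_mul_of_pos_right h5 (by positivity)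
          have e : (j : ℚ) * u * (2 * (2 : ℚ) ^ (q - 1)) = (j : ℚ) * (2 * (u * (2 : ℚ) ^ (q - 1))) := by
            ring
          rw [e, hu2q] at h6
          linarith
        exact_mod_cast h'
      have hmono : B ≤ 2 * (j : ℚ) * u * envG u c (1 / (2 * (j : ℚ))) := by
        have h := hMc j hj1 hjlt'
        unfold MonoZPt at h
        rw [hB]; exact h
      have hjposq : (0 : ℚ) < j := by exact_mod_cast hjpos
      have hρpos : (0 : ℚ) < 1 / (2 * (j : ℚ)) := div_pos one_pos (by linarith)
      obtain ⟨lc', hlc', hGe⟩ := exists_line_eq_envG hupos c hρpos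
      have hread : B ≤ lc'.1 * x + lc'.2 * u := by
        have e : 2 * (j : ℚ) * u * envG u c (1 / (2 * (j : ℚ))) = lc'.1 * x + lc'.2 * u := by
          rw [hGe, hx]; field_simp
        linarith [hmono]
      refine ⟨_, mem_allLines_F4 (b := d) hlc', ?_⟩
      dsimp only
      have hσr := mul_le_mul_of_nonneg_left hread hσpos.le
      have huσ := mul_pos hupos hσpos
      nlinarith

end Close

end Summit.Ventures.CertifiedArithmetic.LowPrec.Opt
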